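import Summits.QuantumFields.BalabanUV.Beta.GAN24.WSlotT2TablesAn1
import Summits.QuantumFields.BalabanUV.Beta.GAN24.WSlotT2Tables
import Summits.QuantumFields.BalabanUV.Beta.GAN24.StencilSlotSAllThree
import Summits.QuantumFields.BalabanUV.Beta.FP.RebaseJets
import Summits.QuantumFields.BalabanUV.Beta.FP.PerfectRebase

/-!
# `BalabanUV.Beta.GAN24.SlotRowsPowBase` — binder row G-an2-4 / (CONV-C): THE S-PAIR AND THE PINNED W-PAIR AT BASE `Lc^m` (EVERY `m ≥ 1`, `Lc ≥ 2`,
# `d = 3`), THEIR LIMIT CLASS DATA, AND THE REBASE PLUGS INTO ROAD «FP»'s `SPerfOf` / `WPerfOf` CURRENCY (road FP owner's RULING R-FP-8 = this row's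
# option (a), journal l.12885 / l.13933; row owner b2b-balaban-gan24-p1, gen 7)

NOT IN PRINT; OUR PROOF ATTEMPT.  HONEST FRAMING (cell contract, verbatim): «discharging `BetaPertH` makes Bałaban's UV stability UNCONDITIONAL — a real
constructive-QFT result; it is NOT the continuum limit and NOT the Clay problem.»  HONEST DEPENDENCY (verbatim): «continuum YM on T⁴ ⇐ BetaPertH ∧ nine spine
estimates (0/9 proved); BetaPertH ⇐ (D1) ∧ (D4) ∧ CAP+tail; G-an2-4 gates asym, D1 and NE2/3/4.»

WHAT.  The wall's S-slot rows (`StencilSlotSAllThree.hS_hSall_three`, p209285) and pinned W-slot rows (`WSlotT2Tables.hW_hWall_three_an1_pinned`, p217017;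
rooted border `WSlotT2TablesAn1.hW_hWall_three_an1At_pinned`, p219710) hold for EVERY base `≥ 2`; road «FP» (binder row D1, `FP/StepLawKHolds.d1Drift_JsBalOf_of_rows_bounded`)
reads, for every `m ≥ 1`, the wall family OF ONE STEP AT BASE `Lc^m` (R-FP-8: the (j,m) families of record are the REBASED wall families, `FP/RebaseJets`).
This module is the supplier the ruling names:
* §1 (generic `d`) `vertexFamily₂_limTabOf_rebaseW` — the W-side twin of `FP.RebaseJets.locStencil_limStOf_rebaseS` (uniform `VertexFamily₂` + geometric Cauchy
  rate of a base-`Lc^m` unit sequence ⊢ `VertexFamily₂` of the rebased family's perfect table); `SPerfOf_of_eq` / `WPerfOf_of_eq` (member-`m` congruence);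
  `mem_box_pow` (a base-`Lc` root is a base-`Lc^m` root).
* §2 (`d = 3`) **`hS_hSall_three_pow`**: the S-pair at base `Lc^m` — `hS_hSall_three (Lc := Lc^m)` with `FP.PerfectRebase.two_le_pow` — and its limit class data
  `locStencil_limStOf_pow` (`HessKerDressedLimit.locStencil_(sub_)limStOf`).
* §3 **`hW_hWall_three_an1_pinned_pow`** / **`hW_hWall_three_an1At_pinned_pow`**: the W-pair at base `Lc^m` for an2's Stage-B family PINNED AT THAT BASE
  (`cE₂ := ((Lc^m : ℕ) : ℝ)^(2*(3+1))`, base border `vh₂S 3 (Lc^m)` resp. an1's rooted border `vh₂SAt (toSite r) (Lc^m)`, mixed table `mixFFAt (toSite r) (Lc^m)`,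
  `r ∈ box (3+1) (Lc^m)`), and its limit class data `vertexFamily₂_limTabOf_pow` at blocking `Lc^m`.
* §4 THE PLUGS (X1m-S / X1m-W of `HOME/b2b-balaban-beta-d1-p3/LEAVES-FP.md` for the rebased families, every `m ≥ 1`): **`locStencil_SPerfOf_rebase_pow`**:
  `∃ Cs δS > 0, LocStencil (SPerfOf (sfStep Lc) (smStep 3 Lc) S m) Cs δS` whenever `S · m = rebaseS Lc m (j′ ↦ (JsBal0Of (Lc := Lc^m) …).S j′)`;
  **`vertexFamily₂_WPerfOf_rebase_pow`** (+ `…At…`): `∃ Cw δW > 0, VertexFamily₂ (WPerfOf (sfStep Lc) (smStep 3 Lc) Wt m) (Lc^m) Cw δW` whenever `Wt · m` is the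
  rebased pinned table family — EXACTLY the binders `hSinf` / `hWinf` of `FP/StepLawKHolds.d1Drift_JsBalOf_of_rows_bounded`.
CAVEAT (l.12885 (i), unchanged): these are the wall objects of ONE step of blocking `Lc^m`; that they ARE road FP's perfect `m`-fold objects is REBASE-J ∕ hSDF
(road FP), NOT claimed here.  HONEST: instantiation + closure bookkeeping, 0 new estimates; NOT «G-an2-4 closed» as (CONV-C) for `G_k`/`H_k`; NOT D1, NOT
BetaPertH, NOT continuum, NOT Clay.  [our object] composition, every input BY NAME; 0 `def`, 0 cite, 0 sorry.
-/

noncomputable section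

open Filter Topology
open Literature.MathematicalPhysics.QuantumFieldTheory
open Literature.MathematicalPhysics.QuantumFieldTheory.Balaban1983to89
open Literature.MathematicalPhysics.QuantumFieldTheory.Balaban1983to89.Beta
open AffineAveraging (box toSite)
open ExpKernelCalculus (MKer VertexFamily₂)
open OneStepResolventKernel (Fib LocStencil)
open BalabanStepJetsSucc (JsBal0Of)
open BalabanStepW2 (WbalOf T2Of)
open AveragingMixedJetTables (vh₂S vh₂SAt mixFFAt)
open HessKerDressedLimit (limStOf limTabOf locStencil_limStOf locStencil_sub_limStOf vertexFamily₂_limTabOf vertexFamily₂_sub_limTabOf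
  tendsto_of_biLoc_rate)
open Summit.QuantumFields.BalabanUV.Beta.HessKerDressedUnits (unitS unitW)
open Summit.QuantumFields.BalabanUV.Beta.GAN24.CombesThomas (sfStep smStep)
open Summit.QuantumFields.BalabanUV.Beta.GAN24.StencilSlotOfE3 (one_le_of_two_le)
open Summit.QuantumFields.BalabanUV.Beta.GAN24.StencilSlotSAllThree (hS_hSall_three)
open Summit.QuantumFields.BalabanUV.Beta.GAN24.WSlotT2Tables (hW_hWall_three_an1_pinned)
open Summit.QuantumFields.BalabanUV.Beta.GAN24.WSlotT2TablesAn1 (hW_hWall_three_an1At_pinned)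
open Summit.QuantumFields.BalabanUV.Beta.FP.PerfectObjectsT (SPerfOf WPerfOf)
open Summit.QuantumFields.BalabanUV.Beta.FP.RebaseJets (rebaseS rebaseW limTabOf_rebaseW locStencil_limStOf_rebaseS)
open Summit.QuantumFields.BalabanUV.Beta.FP.PerfectRebase (two_le_pow)

namespace Summit.QuantumFields.BalabanUV.Beta.GAN24.SlotRowsPowBase

/-! ## §1 Generic `d`: the W-side rebase wrapper, member-`m` congruences, roots -/

section Generic

variable {d : ℕ} {Lc : ℕ} [NeZero Lc] {m : ℕ}

/-- **hWinf BY REBASE** (W-side twin of `FP.RebaseJets.locStencil_limStOf_rebaseS`): uniform `VertexFamily₂` + geometric Cauchy rate of the base-`Lc^m`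
unit table sequence (blocking `N`, any) give `VertexFamily₂` of the rebased family's perfect table `limTabOf (j ↦ unitW (sfStep Lc j) (smStep d Lc j) (rebaseW … j))`
at the same blocking and constants. [folklore] -/
theorem vertexFamily₂_limTabOf_rebaseW (hm : m ≠ 0)
    (WL : ℕ → Fin (d + 1) → (Fin (d + 1) → ℤ) → Fin (d + 1) → (Fin (d + 1) → ℤ) → MKer (d + 1) (Fib d)) {N : ℕ} {Cw c δ δ' θ : ℝ}
    (hW : ∀ j', VertexFamily₂ (unitW (sfStep (Lc ^ m) j') (smStep d (Lc ^ m) j') (WL j')) N Cw δ')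
    (hWall : ∀ k j', VertexFamily₂ (unitW (sfStep (Lc ^ m) (k + j')) (smStep d (Lc ^ m) (k + j')) (WL (k + j'))
      - unitW (sfStep (Lc ^ m) k) (smStep d (Lc ^ m) k) (WL k)) N (c * θ ^ k) δ)
    (hθ0 : 0 ≤ θ) (hθ1 : θ < 1) :
    VertexFamily₂ (limTabOf (fun j => unitW (sfStep Lc j) (smStep d Lc j) (rebaseW Lc m WL j))) N Cw δ' := by
  set U : ℕ → Fin (d + 1) → (Fin (d + 1) → ℤ) → Fin (d + 1) → (Fin (d + 1) → ℤ) → MKer (d + 1) (Fib d) :=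
    fun j' => unitW (sfStep (Lc ^ m) j') (smStep d (Lc ^ m) j') (WL j') with hU
  have hconv : ∀ μ y ν y' x z a b, Tendsto (fun j' => U j' μ y ν y' x z a b) atTop (𝓝 (limTabOf U μ y ν y' x z a b)) := by
    intro μ y ν y' x z a b
    have hr := vertexFamily₂_sub_limTabOf (W := U) (fun k j => hWall k j) hθ1
    exact tendsto_of_biLoc_rate (T := fun k => U k μ y ν y') (Tinf := limTabOf U μ y ν y') (c := c) (δ := δ)
      (fun k => by simpa only [Pi.sub_apply] using hr k μ y ν y') hθ0 hθ1 x z a b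
  rw [limTabOf_rebaseW hm WL hconv]
  exact vertexFamily₂_limTabOf hW hWall hθ1

/-- Member-`m` congruence of `SPerfOf` (the `m`-general form of `PerfectObjectsT.SPerfOf_one`). [folklore] -/
theorem SPerfOf_of_eq (sf sm : ℕ → ℝ) {S : ℕ → ℕ → Fin (d + 1) → (Fin (d + 1) → ℤ) → MKer (d + 1) (Fib d)}
    {Sm : ℕ → Fin (d + 1) → (Fin (d + 1) → ℤ) → MKer (d + 1) (Fib d)} (hSm : ∀ j, S j m = Sm j) :
    SPerfOf sf sm S m = limStOf fun j => unitS (sf j) (sm j) (Sm j) := by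
  unfold SPerfOf; simp only [hSm]

/-- Member-`m` congruence of `WPerfOf` (the `m`-general form of `PerfectObjectsT.WPerfOf_one`). [folklore] -/
theorem WPerfOf_of_eq (sf sm : ℕ → ℝ) {Wt : ℕ → ℕ → Fin (d + 1) → (Fin (d + 1) → ℤ) → Fin (d + 1) → (Fin (d + 1) → ℤ) → MKer (d + 1) (Fib d)}
    {Wm : ℕ → Fin (d + 1) → (Fin (d + 1) → ℤ) → Fin (d + 1) → (Fin (d + 1) → ℤ) → MKer (d + 1) (Fib d)} (hWm : ∀ j, Wt j m = Wm j) :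
    WPerfOf sf sm Wt m = limTabOf fun j => unitW (sf j) (sm j) (Wm j) := by
  unfold WPerfOf; simp only [hWm]

omit [NeZero Lc] in
/-- A base-`Lc` block root is a base-`Lc^m` block root (`1 ≤ m`). [folklore] -/
theorem mem_box_pow {r : Fin (d + 1) → ℕ} (hr : r ∈ box (d + 1) Lc) (hm : 1 ≤ m) : r ∈ box (d + 1) (Lc ^ m) := by
  simp only [AffineAveraging.box, Fintype.mem_piFinset, Finset.mem_range] at hr ⊢
  exact fun i => (hr i).trans_le (Nat.le_self_pow (Nat.one_le_iff_ne_zero.1 hm) Lc)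

end Generic

/-! ## §2 `d = 3`: the S-pair at base `Lc^m` and its limit class data -/

section SThree

variable {Lc : ℕ} [NeZero Lc] {m : ℕ}

/-- **THE WALL's S-PAIR AT BASE `Lc^m`** (`2 ≤ Lc`, `1 ≤ m`; units `(sfStep (Lc^m) j′, smStep 3 (Lc^m) j′)`): `StencilSlotSAllThree.hS_hSall_three` at `Lc := Lc^m`.
[our object] instantiation. -/
theorem hS_hSall_three_pow (hLc : 2 ≤ Lc) (hm : 1 ≤ m) (cE cVH cΛ : ℝ)
    (W : ℕ → Fin (3 + 1) → (Fin (3 + 1) → ℤ) → Fin (3 + 1) → (Fin (3 + 1) → ℤ) → MKer (3 + 1) (Fib 3))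
    (Cw δw : ℕ → ℝ) (hδw : ∀ j, 0 < δw j) (hW' : ∀ j, VertexFamily₂ (W j) (Lc ^ m) (Cw j) (δw j)) :
    ∃ Cs cS θS δS : ℝ, 0 ≤ θS ∧ θS < 1 ∧ 0 < δS ∧
      (∀ j', LocStencil (unitS (sfStep (Lc ^ m) j') (smStep 3 (Lc ^ m) j')
        (JsBal0Of (one_le_of_two_le (two_le_pow hLc hm)) cE cVH cΛ W Cw δw hδw hW' j').S) Cs δS) ∧
      (∀ k j', LocStencil (unitS (sfStep (Lc ^ m) (k + j')) (smStep 3 (Lc ^ m) (k + j'))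
          (JsBal0Of (one_le_of_two_le (two_le_pow hLc hm)) cE cVH cΛ W Cw δw hδw hW' (k + j')).S -
        unitS (sfStep (Lc ^ m) k) (smStep 3 (Lc ^ m) k) (JsBal0Of (one_le_of_two_le (two_le_pow hLc hm)) cE cVH cΛ W Cw δw hδw hW' k).S)
        (cS * θS ^ k) δS) :=
  hS_hSall_three (Lc := Lc ^ m) (two_le_pow hLc hm) cE cVH cΛ W Cw δw hδw hW'

/-- **LIMIT CLASS DATA OF THE S-PAIR AT BASE `Lc^m`**: the constructed limit stencil of the base-`Lc^m` unit sequence is a local stencil family with the SAME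
constant, and the sequence converges to it at the geometric rate (asym1's closure lemmas `locStencil_limStOf` / `locStencil_sub_limStOf`). [our object] -/
theorem locStencil_limStOf_pow (hLc : 2 ≤ Lc) (hm : 1 ≤ m) (cE cVH cΛ : ℝ)
    (W : ℕ → Fin (3 + 1) → (Fin (3 + 1) → ℤ) → Fin (3 + 1) → (Fin (3 + 1) → ℤ) → MKer (3 + 1) (Fib 3))
    (Cw δw : ℕ → ℝ) (hδw : ∀ j, 0 < δw j) (hW' : ∀ j, VertexFamily₂ (W j) (Lc ^ m) (Cw j) (δw j)) :
    ∃ Cs cS θS δS : ℝ, 0 ≤ θS ∧ θS < 1 ∧ 0 < δS ∧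
      LocStencil (limStOf fun j' => unitS (sfStep (Lc ^ m) j') (smStep 3 (Lc ^ m) j')
        (JsBal0Of (one_le_of_two_le (two_le_pow hLc hm)) cE cVH cΛ W Cw δw hδw hW' j').S) Cs δS ∧
      ∀ k, LocStencil (unitS (sfStep (Lc ^ m) k) (smStep 3 (Lc ^ m) k)
          (JsBal0Of (one_le_of_two_le (two_le_pow hLc hm)) cE cVH cΛ W Cw δw hδw hW' k).S -
        limStOf (fun j' => unitS (sfStep (Lc ^ m) j') (smStep 3 (Lc ^ m) j')
          (JsBal0Of (one_le_of_two_le (two_le_pow hLc hm)) cE cVH cΛ W Cw δw hδw hW' j').S)) (cS * θS ^ k) δS := by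
  obtain ⟨Cs, cS, θS, δS, hθ0, hθ1, hδ, hS, hSall⟩ := hS_hSall_three_pow hLc hm cE cVH cΛ W Cw δw hδw hW'
  exact ⟨Cs, cS, θS, δS, hθ0, hθ1, hδ,
    locStencil_limStOf (S := fun j' => unitS (sfStep (Lc ^ m) j') (smStep 3 (Lc ^ m) j')
      (JsBal0Of (one_le_of_two_le (two_le_pow hLc hm)) cE cVH cΛ W Cw δw hδw hW' j').S) hS hSall hθ1,
    locStencil_sub_limStOf (S := fun j' => unitS (sfStep (Lc ^ m) j') (smStep 3 (Lc ^ m) j')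
      (JsBal0Of (one_le_of_two_le (two_le_pow hLc hm)) cE cVH cΛ W Cw δw hδw hW' j').S) hSall hθ1⟩

end SThree

/-! ## §3 `d = 3`: the pinned W-pair at base `Lc^m` (base border / an1's rooted border) and its limit class data -/

section WThree

variable {Lc : ℕ} [NeZero Lc] {m : ℕ} {r : Fin (3 + 1) → ℕ}

/-- **THE WALL's W-PAIR AT BASE `Lc^m` FOR THE MEMBER PINNED AT THAT BASE** (`cE₂ := ((Lc^m : ℕ) : ℝ)^(2*(3+1))`, base border `vh₂S 3 (Lc^m)`, an1's mixed table
`mixFFAt (toSite r) (Lc^m)`, `r ∈ box (3+1) (Lc^m)`; blocking `Lc^m`): `WSlotT2Tables.hW_hWall_three_an1_pinned` at `Lc := Lc^m`. [our object] instantiation. -/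
theorem hW_hWall_three_an1_pinned_pow (hLc : 2 ≤ Lc) (hm : 1 ≤ m) (hr : r ∈ box (3 + 1) (Lc ^ m)) (cE cVH cΛ cB : ℝ)
    (Tc : Fin 4 → Fin 4 → Fin 4 → Fin 4 → ℝ) :
    ∃ Cw cW θW δW : ℝ, 0 ≤ θW ∧ θW < 1 ∧ 0 < δW ∧
      (∀ j', VertexFamily₂ (unitW (sfStep (Lc ^ m) j') (smStep 3 (Lc ^ m) j') (WbalOf 3 (Lc ^ m) cE cVH cΛ
        (T2Of 3 (Lc ^ m) cE cVH cΛ (((Lc ^ m : ℕ) : ℝ) ^ (2 * (3 + 1))) cB Tc (vh₂S 3 (Lc ^ m)) (mixFFAt (toSite r) (Lc ^ m)))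
        (mixFFAt (toSite r) (Lc ^ m)) j')) (Lc ^ m) Cw δW) ∧
      (∀ k j', VertexFamily₂ (unitW (sfStep (Lc ^ m) (k + j')) (smStep 3 (Lc ^ m) (k + j')) (WbalOf 3 (Lc ^ m) cE cVH cΛ
          (T2Of 3 (Lc ^ m) cE cVH cΛ (((Lc ^ m : ℕ) : ℝ) ^ (2 * (3 + 1))) cB Tc (vh₂S 3 (Lc ^ m)) (mixFFAt (toSite r) (Lc ^ m)))
          (mixFFAt (toSite r) (Lc ^ m)) (k + j')) -
        unitW (sfStep (Lc ^ m) k) (smStep 3 (Lc ^ m) k) (WbalOf 3 (Lc ^ m) cE cVH cΛ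
          (T2Of 3 (Lc ^ m) cE cVH cΛ (((Lc ^ m : ℕ) : ℝ) ^ (2 * (3 + 1))) cB Tc (vh₂S 3 (Lc ^ m)) (mixFFAt (toSite r) (Lc ^ m)))
          (mixFFAt (toSite r) (Lc ^ m)) k)) (Lc ^ m) (cW * θW ^ k) δW) :=
  hW_hWall_three_an1_pinned (Lc := Lc ^ m) (two_le_pow hLc hm) hr cE cVH cΛ cB Tc

/-- **THE SAME AT an1's ROOTED BORDER** `vh₂SAt (toSite r) (Lc^m)` (row (B) of `SLOT-COVERAGE.md`; road BF-x's literal at base `Lc^m`):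
`WSlotT2TablesAn1.hW_hWall_three_an1At_pinned` at `Lc := Lc^m`. [our object] instantiation. -/
theorem hW_hWall_three_an1At_pinned_pow (hLc : 2 ≤ Lc) (hm : 1 ≤ m) (hr : r ∈ box (3 + 1) (Lc ^ m)) (cE cVH cΛ cB : ℝ)
    (Tc : Fin 4 → Fin 4 → Fin 4 → Fin 4 → ℝ) :
    ∃ Cw cW θW δW : ℝ, 0 ≤ θW ∧ θW < 1 ∧ 0 < δW ∧
      (∀ j', VertexFamily₂ (unitW (sfStep (Lc ^ m) j') (smStep 3 (Lc ^ m) j') (WbalOf 3 (Lc ^ m) cE cVH cΛ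
        (T2Of 3 (Lc ^ m) cE cVH cΛ (((Lc ^ m : ℕ) : ℝ) ^ (2 * (3 + 1))) cB Tc (vh₂SAt (toSite r) (Lc ^ m)) (mixFFAt (toSite r) (Lc ^ m)))
        (mixFFAt (toSite r) (Lc ^ m)) j')) (Lc ^ m) Cw δW) ∧
      (∀ k j', VertexFamily₂ (unitW (sfStep (Lc ^ m) (k + j')) (smStep 3 (Lc ^ m) (k + j')) (WbalOf 3 (Lc ^ m) cE cVH cΛ
          (T2Of 3 (Lc ^ m) cE cVH cΛ (((Lc ^ m : ℕ) : ℝ) ^ (2 * (3 + 1))) cB Tc (vh₂SAt (toSite r) (Lc ^ m)) (mixFFAt (toSite r) (Lc ^ m)))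
          (mixFFAt (toSite r) (Lc ^ m)) (k + j')) -
        unitW (sfStep (Lc ^ m) k) (smStep 3 (Lc ^ m) k) (WbalOf 3 (Lc ^ m) cE cVH cΛ
          (T2Of 3 (Lc ^ m) cE cVH cΛ (((Lc ^ m : ℕ) : ℝ) ^ (2 * (3 + 1))) cB Tc (vh₂SAt (toSite r) (Lc ^ m)) (mixFFAt (toSite r) (Lc ^ m)))
          (mixFFAt (toSite r) (Lc ^ m)) k)) (Lc ^ m) (cW * θW ^ k) δW) :=
  hW_hWall_three_an1At_pinned (Lc := Lc ^ m) (two_le_pow hLc hm) hr cE cVH cΛ cB Tc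

/-- **LIMIT CLASS DATA OF THE PINNED W-PAIR AT BASE `Lc^m`** (base border; blocking `Lc^m`): the constructed limit table is a `VertexFamily₂` with the SAME constant
and the unit sequence converges to it at the geometric rate (asym1's `vertexFamily₂_limTabOf` / `vertexFamily₂_sub_limTabOf`). [our object] -/
theorem vertexFamily₂_limTabOf_pow (hLc : 2 ≤ Lc) (hm : 1 ≤ m) (hr : r ∈ box (3 + 1) (Lc ^ m)) (cE cVH cΛ cB : ℝ)
    (Tc : Fin 4 → Fin 4 → Fin 4 → Fin 4 → ℝ) :
    ∃ Cw cW θW δW : ℝ, 0 ≤ θW ∧ θW < 1 ∧ 0 < δW ∧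
      VertexFamily₂ (limTabOf fun j' => unitW (sfStep (Lc ^ m) j') (smStep 3 (Lc ^ m) j') (WbalOf 3 (Lc ^ m) cE cVH cΛ
        (T2Of 3 (Lc ^ m) cE cVH cΛ (((Lc ^ m : ℕ) : ℝ) ^ (2 * (3 + 1))) cB Tc (vh₂S 3 (Lc ^ m)) (mixFFAt (toSite r) (Lc ^ m)))
        (mixFFAt (toSite r) (Lc ^ m)) j')) (Lc ^ m) Cw δW ∧
      ∀ k, VertexFamily₂ (unitW (sfStep (Lc ^ m) k) (smStep 3 (Lc ^ m) k) (WbalOf 3 (Lc ^ m) cE cVH cΛ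
          (T2Of 3 (Lc ^ m) cE cVH cΛ (((Lc ^ m : ℕ) : ℝ) ^ (2 * (3 + 1))) cB Tc (vh₂S 3 (Lc ^ m)) (mixFFAt (toSite r) (Lc ^ m)))
          (mixFFAt (toSite r) (Lc ^ m)) k) -
        limTabOf (fun j' => unitW (sfStep (Lc ^ m) j') (smStep 3 (Lc ^ m) j') (WbalOf 3 (Lc ^ m) cE cVH cΛ
          (T2Of 3 (Lc ^ m) cE cVH cΛ (((Lc ^ m : ℕ) : ℝ) ^ (2 * (3 + 1))) cB Tc (vh₂S 3 (Lc ^ m)) (mixFFAt (toSite r) (Lc ^ m)))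
          (mixFFAt (toSite r) (Lc ^ m)) j'))) (Lc ^ m) (cW * θW ^ k) δW := by
  obtain ⟨Cw, cW, θW, δW, hθ0, hθ1, hδ, hW, hWall⟩ := hW_hWall_three_an1_pinned_pow hLc hm hr cE cVH cΛ cB Tc
  exact ⟨Cw, cW, θW, δW, hθ0, hθ1, hδ,
    vertexFamily₂_limTabOf (W := fun j' => unitW (sfStep (Lc ^ m) j') (smStep 3 (Lc ^ m) j') (WbalOf 3 (Lc ^ m) cE cVH cΛ
      (T2Of 3 (Lc ^ m) cE cVH cΛ (((Lc ^ m : ℕ) : ℝ) ^ (2 * (3 + 1))) cB Tc (vh₂S 3 (Lc ^ m)) (mixFFAt (toSite r) (Lc ^ m)))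
      (mixFFAt (toSite r) (Lc ^ m)) j')) hW hWall hθ1,
    vertexFamily₂_sub_limTabOf (W := fun j' => unitW (sfStep (Lc ^ m) j') (smStep 3 (Lc ^ m) j') (WbalOf 3 (Lc ^ m) cE cVH cΛ
      (T2Of 3 (Lc ^ m) cE cVH cΛ (((Lc ^ m : ℕ) : ℝ) ^ (2 * (3 + 1))) cB Tc (vh₂S 3 (Lc ^ m)) (mixFFAt (toSite r) (Lc ^ m)))
      (mixFFAt (toSite r) (Lc ^ m)) j')) hWall hθ1⟩

end WThree

/-! ## §4 THE PLUGS: road «FP»'s `hSinf` / `hWinf` for the rebased families, every `m ≥ 1` (X1m-S / X1m-W by REBASE) -/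

section Plugs

variable {Lc : ℕ} [NeZero Lc] {m : ℕ} {r : Fin (3 + 1) → ℕ}

/-- **X1m-S BY REBASE, EVERY `m ≥ 1`** (`2 ≤ Lc`): if the member-`m` column of road FP's (j,m) stencil family is the REBASED base-`Lc^m` wall family
`rebaseS Lc m (j′ ↦ (JsBal0Of (Lc := Lc^m) …).S j′)`, then its perfect stencil `SPerfOf (sfStep Lc) (smStep 3 Lc) S m` is a local stencil family —
the binder `hSinf` of `FP/StepLawKHolds.d1Drift_JsBalOf_of_rows_bounded` at `m`.  §2 + `FP.RebaseJets.locStencil_limStOf_rebaseS`. [our object] composition. -/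
theorem locStencil_SPerfOf_rebase_pow (hLc : 2 ≤ Lc) (hm : 1 ≤ m) (cE cVH cΛ : ℝ)
    (W : ℕ → Fin (3 + 1) → (Fin (3 + 1) → ℤ) → Fin (3 + 1) → (Fin (3 + 1) → ℤ) → MKer (3 + 1) (Fib 3))
    (Cw δw : ℕ → ℝ) (hδw : ∀ j, 0 < δw j) (hW' : ∀ j, VertexFamily₂ (W j) (Lc ^ m) (Cw j) (δw j))
    {S : ℕ → ℕ → Fin (3 + 1) → (Fin (3 + 1) → ℤ) → MKer (3 + 1) (Fib 3)}
    (hSm : ∀ j, S j m = rebaseS Lc m (fun j' => (JsBal0Of (one_le_of_two_le (two_le_pow hLc hm)) cE cVH cΛ W Cw δw hδw hW' j').S) j) :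
    ∃ Cs δS : ℝ, 0 < δS ∧ LocStencil (SPerfOf (sfStep Lc) (smStep 3 Lc) S m) Cs δS := by
  obtain ⟨Cs, cS, θS, δS, hθ0, hθ1, hδ, hS, hSall⟩ := hS_hSall_three_pow hLc hm cE cVH cΛ W Cw δw hδw hW'
  refine ⟨Cs, δS, hδ, ?_⟩
  rw [SPerfOf_of_eq (sfStep Lc) (smStep 3 Lc) hSm]
  exact locStencil_limStOf_rebaseS (Nat.one_le_iff_ne_zero.1 hm) _ hS hSall hθ0 hθ1

/-- **X1m-W BY REBASE, EVERY `m ≥ 1`, PINNED MEMBER, BASE BORDER** (`2 ≤ Lc`, `r ∈ box (3+1) (Lc^m)`): if the member-`m` column of road FP's (j,m) table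
family is the REBASED base-`Lc^m` pinned table family, its perfect table `WPerfOf (sfStep Lc) (smStep 3 Lc) Wt m` is a `VertexFamily₂` at blocking `Lc^m` —
the binder `hWinf` of `FP/StepLawKHolds.d1Drift_JsBalOf_of_rows_bounded` at `m`.  §3 + §1. [our object] composition. -/
theorem vertexFamily₂_WPerfOf_rebase_pow (hLc : 2 ≤ Lc) (hm : 1 ≤ m) (hr : r ∈ box (3 + 1) (Lc ^ m)) (cE cVH cΛ cB : ℝ)
    (Tc : Fin 4 → Fin 4 → Fin 4 → Fin 4 → ℝ)
    {Wt : ℕ → ℕ → Fin (3 + 1) → (Fin (3 + 1) → ℤ) → Fin (3 + 1) → (Fin (3 + 1) → ℤ) → MKer (3 + 1) (Fib 3)}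
    (hWm : ∀ j, Wt j m = rebaseW Lc m (WbalOf 3 (Lc ^ m) cE cVH cΛ
      (T2Of 3 (Lc ^ m) cE cVH cΛ (((Lc ^ m : ℕ) : ℝ) ^ (2 * (3 + 1))) cB Tc (vh₂S 3 (Lc ^ m)) (mixFFAt (toSite r) (Lc ^ m)))
      (mixFFAt (toSite r) (Lc ^ m))) j) :
    ∃ Cw δW : ℝ, 0 < δW ∧ VertexFamily₂ (WPerfOf (sfStep Lc) (smStep 3 Lc) Wt m) (Lc ^ m) Cw δW := by
  obtain ⟨Cw, cW, θW, δW, hθ0, hθ1, hδ, hW, hWall⟩ := hW_hWall_three_an1_pinned_pow hLc hm hr cE cVH cΛ cB Tc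
  refine ⟨Cw, δW, hδ, ?_⟩
  rw [WPerfOf_of_eq (sfStep Lc) (smStep 3 Lc) hWm]
  exact vertexFamily₂_limTabOf_rebaseW (Nat.one_le_iff_ne_zero.1 hm) _ hW hWall hθ0 hθ1

/-- **X1m-W BY REBASE AT an1's ROOTED BORDER** (row (B); road BF-x's literal at base `Lc^m`). [our object] composition. -/
theorem vertexFamily₂_WPerfOf_rebaseAt_pow (hLc : 2 ≤ Lc) (hm : 1 ≤ m) (hr : r ∈ box (3 + 1) (Lc ^ m)) (cE cVH cΛ cB : ℝ)
    (Tc : Fin 4 → Fin 4 → Fin 4 → Fin 4 → ℝ)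
    {Wt : ℕ → ℕ → Fin (3 + 1) → (Fin (3 + 1) → ℤ) → Fin (3 + 1) → (Fin (3 + 1) → ℤ) → MKer (3 + 1) (Fib 3)}
    (hWm : ∀ j, Wt j m = rebaseW Lc m (WbalOf 3 (Lc ^ m) cE cVH cΛ
      (T2Of 3 (Lc ^ m) cE cVH cΛ (((Lc ^ m : ℕ) : ℝ) ^ (2 * (3 + 1))) cB Tc (vh₂SAt (toSite r) (Lc ^ m)) (mixFFAt (toSite r) (Lc ^ m)))
      (mixFFAt (toSite r) (Lc ^ m))) j) :
    ∃ Cw δW : ℝ, 0 < δW ∧ VertexFamily₂ (WPerfOf (sfStep Lc) (smStep 3 Lc) Wt m) (Lc ^ m) Cw δW := by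
  obtain ⟨Cw, cW, θW, δW, hθ0, hθ1, hδ, hW, hWall⟩ := hW_hWall_three_an1At_pinned_pow hLc hm hr cE cVH cΛ cB Tc
  refine ⟨Cw, δW, hδ, ?_⟩
  rw [WPerfOf_of_eq (sfStep Lc) (smStep 3 Lc) hWm]
  exact vertexFamily₂_limTabOf_rebaseW (Nat.one_le_iff_ne_zero.1 hm) _ hW hWall hθ0 hθ1

end Plugs

end Summit.QuantumFields.BalabanUV.Beta.GAN24.SlotRowsPowBase

end
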